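import Mathlib
import HarnessLib
import Summits.HubbardSuperconductivity.HubbardSuperconductivity.Theorems.KLProgrammeKLRegimeSplitFrameExtFnSymmetric

/-!
# Route `KLProgramme`, crux K3 — Δ23 / (R-I): Salmhofer's cutoff `χ₂` has BOUNDED DERIVATIVES OF EVERY ORDER, hence the de-interpolated
# G-extension satisfies `‖Dⁿ (onM (klFrameExtFn μ f)) q‖ ≤ [n=0]·|mean f| + C_n·G` with a PROFILE-FREE, VOLUME-FREE constant `C_n`

Cell gate-hubbard-kl, seat hubbard-kl-k3c3-p1 (g2).  Closes the symbol-side chain `…SplitPolarAngleDerivBounds` → `…SplitFrameExtSymbolBounds`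
→ `…SplitFlatCutoffSymbol` → `…SplitFrameExtFnBounds` → `…SplitFrameExtFnSymmetric`: the one non-numeral input there was `X ≥ sup_{l ≤ n} ‖Dˡχ₂‖`
(`χ₂ = salmhoferCutoff = smoothTransition((4x−1)/3)`).  Here:

* §1 `iteratedFDeriv_salmhoferCutoff_eq_zero` (positive-order derivatives vanish off `[1/4, 1]`, where `χ₂` is locally constant),
  `exists_norm_iteratedFDeriv_salmhoferCutoff_le` / `…_all` (**`∃ X ≥ 1, ∀ l ≤ n, ∀ x, ‖Dˡχ₂(x)‖ ≤ X`** — continuity on the compact `[1/4,1]`);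
* §2 **`exists_const_norm_iteratedFDeriv_onM_klFrameExtFn_le`**: for every order `n` there is `C_n ≥ 0` (depending on NOTHING else) with
  `‖Dⁿ (onM (klFrameExtFn μ f)) q‖ ≤ [n=0]·|klAngularMean f| + C_n·G` for every `μ ∈ klWindowC`, every `C^N` `2π`-periodic `f` with
  `‖Dⁱ(f − klAngularMean f)‖ ≤ G` (`i ≤ n ≤ N`) and every `q` — the shape in which the ENGINE certifies (E3a-Fn)/`FrameOKFn` (ii) for the
  emitted pieces: the angular size `G` of the mean-free increment carries the whole scale law, `C_n` is the numeral behind `G.S n`.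

Explicit numerals for `X` (k3c2-p2's lane: `|χ₂′| ≤ 32/3`, …) sharpen `C_n` but are not needed for certifiability.  Proofs only; nothing is
asserted about the model.
-/

noncomputable section

namespace Summit.HubbardSuperconductivity.HubbardSuperconductivity.Theorems.KLRegimeSplit

set_option linter.dupNamespace false -- summit = problem name (single-conjunct summit), D-0017

open Real Finset Filter Literature.MathematicalPhysics.QuantumLattice Literature.MathematicalPhysics.QuantumLattice.FermiRG
open scoped Topology

/-! ## §1 Salmhofer's cutoff has bounded derivatives of every order -/

/-- Off `[1/4, 1]` every derivative of positive order of `χ₂` vanishes (it is locally constant there). -/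
theorem iteratedFDeriv_salmhoferCutoff_eq_zero {x : ℝ} (hx : x < 1 / 4 ∨ 1 < x) {l : ℕ} (hl : 1 ≤ l) :
    iteratedFDeriv ℝ l salmhoferCutoff x = 0 := by
  rcases hx with hx | hx
  · have hev : salmhoferCutoff =ᶠ[𝓝 x] fun _ => (0 : ℝ) := by
      filter_upwards [Iio_mem_nhds hx] with y hy
      exact salmhoferCutoff_of_le (le_of_lt hy)
    rw [(hev.iteratedFDeriv ℝ l).eq_of_nhds, iteratedFDeriv_const_of_ne (by omega)]
    rfl
  · have hev : salmhoferCutoff =ᶠ[𝓝 x] fun _ => (1 : ℝ) := by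
      filter_upwards [Ioi_mem_nhds hx] with y hy
      exact salmhoferCutoff_of_ge (le_of_lt hy)
    rw [(hev.iteratedFDeriv ℝ l).eq_of_nhds, iteratedFDeriv_const_of_ne (by omega)]
    rfl

/-- **Every derivative of `χ₂` is bounded on `ℝ`** (continuous, and zero off the compact `[1/4, 1]` for positive order; `χ₂ ∈ [0,1]`). -/
theorem exists_norm_iteratedFDeriv_salmhoferCutoff_le (l : ℕ) : ∃ X : ℝ, 1 ≤ X ∧ ∀ x : ℝ, ‖iteratedFDeriv ℝ l salmhoferCutoff x‖ ≤ X := by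
  have hcont : Continuous fun x => iteratedFDeriv ℝ l salmhoferCutoff x :=
    (contDiff_salmhoferCutoff (n := l)).continuous_iteratedFDeriv' 
  obtain ⟨B, hB⟩ := (isCompact_Icc (a := (1 / 4 : ℝ)) (b := 1)).exists_bound_of_continuousOn hcont.continuousOn
  refine ⟨max 1 B, le_max_left _ _, fun x => ?_⟩
  by_cases hx : x ∈ Set.Icc (1 / 4 : ℝ) 1
  · exact (hB x hx).trans (le_max_right _ _)
  · rw [Set.mem_Icc, not_and_or, not_le, not_le] at hx
    rcases Nat.eq_zero_or_pos l with rfl | hpos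
    · rw [iteratedFDeriv_zero_eq_comp, Function.comp_apply, LinearIsometryEquiv.norm_map, Real.norm_eq_abs,
        abs_of_nonneg (salmhoferCutoff_mem_Icc x).1]
      exact (salmhoferCutoff_mem_Icc x).2.trans (le_max_left _ _)
    · rw [iteratedFDeriv_salmhoferCutoff_eq_zero hx hpos, norm_zero]
      exact zero_le_one.trans (le_max_left _ _)

/-- **A single bound for all orders `≤ n`.** -/
theorem exists_norm_iteratedFDeriv_salmhoferCutoff_le_all (n : ℕ) :
    ∃ X : ℝ, 1 ≤ X ∧ ∀ l ≤ n, ∀ x : ℝ, ‖iteratedFDeriv ℝ l salmhoferCutoff x‖ ≤ X := by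
  induction n with
  | zero =>
    obtain ⟨X, hX1, hX⟩ := exists_norm_iteratedFDeriv_salmhoferCutoff_le 0
    exact ⟨X, hX1, fun l hl x => by rw [Nat.le_zero.mp hl]; exact hX x⟩
  | succ n ih =>
    obtain ⟨X, hX1, hX⟩ := ih
    obtain ⟨Y, hY1, hY⟩ := exists_norm_iteratedFDeriv_salmhoferCutoff_le (n + 1)
    refine ⟨max X Y, hX1.trans (le_max_left _ _), fun l hl x => ?_⟩
    rcases Nat.lt_or_ge l (n + 1) with hlt | hge
    · exact (hX l (Nat.lt_succ_iff.mp hlt) x).trans (le_max_left _ _)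
    · rw [le_antisymm hl hge]; exact (hY x).trans (le_max_right _ _)

/-! ## §2 The `∃ C_n` form of the G-extension bounds -/

/-- **A volume-free, scale-free, profile-free numeral `C_n`** such that for every `μ ∈ klWindowC`, every `C^N` `2π`-periodic profile `f`
with `‖Dⁱ(f − mean f)‖ ≤ G` (`i ≤ n`) and every momentum `q`:
`‖Dⁿ (onM (klFrameExtFn μ f)) q‖ ≤ [n=0]·|mean f| + C_n·G`.  (`C_n = (n!)²·(2·n!·X_n·200ⁿ)·(4 + max 1 (5(n−1)!/8))ⁿ` with `X_n` the bound
of §1; the engine may take this `C_n` as the numeral behind its `G.S n`/`Q.S' n` choice.) -/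
theorem exists_const_norm_iteratedFDeriv_onM_klFrameExtFn_le (n : ℕ) :
    ∃ C : ℝ, 0 ≤ C ∧ ∀ {f : ℝ → ℝ} {N : WithTop ℕ∞}, ContDiff ℝ N f → Function.Periodic f (2 * Real.pi) → (n : WithTop ℕ∞) ≤ N →
      ∀ {G μ : ℝ}, μ ∈ klWindowC → (∀ i ≤ n, ∀ t : ℝ, ‖iteratedFDeriv ℝ i (fun t => f t - klAngularMean f) t‖ ≤ G) →
        ∀ q : Momentum, ‖iteratedFDeriv ℝ n (onM (klFrameExtFn μ f)) q‖ ≤ (if n = 0 then |klAngularMean f| else 0) + C * G := by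
  obtain ⟨X, hX1, hX⟩ := exists_norm_iteratedFDeriv_salmhoferCutoff_le_all n
  refine ⟨(n.factorial : ℝ) ^ 2 * (2 * n.factorial * X * 200 ^ n) * (4 + max 1 (((n - 1).factorial : ℝ) / (8 / 5))) ^ n,
    by positivity, @fun f N hf hper hn G μ hμ hG q => ?_⟩
  have h := norm_iteratedFDeriv_onM_klFrameExtFn_le hf hper hn hμ hG hX q
  calc ‖iteratedFDeriv ℝ n (onM (klFrameExtFn μ f)) q‖
      ≤ (if n = 0 then |klAngularMean f| else 0) +
          (n.factorial : ℝ) ^ 2 * (2 * n.factorial * X * 200 ^ n) * G * (4 + max 1 (((n - 1).factorial : ℝ) / (8 / 5))) ^ n := h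
    _ = (if n = 0 then |klAngularMean f| else 0) +
          (n.factorial : ℝ) ^ 2 * (2 * n.factorial * X * 200 ^ n) * (4 + max 1 (((n - 1).factorial : ℝ) / (8 / 5))) ^ n * G := by
        ring

end Summit.HubbardSuperconductivity.HubbardSuperconductivity.Theorems.KLRegimeSplit

end
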